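import Summits.QuantumAdvantage.QuantumAdvantage.Theorems.LinnikCubicClassGroupsDegreeOnePrimesEscapeFrobeniusLeastDegOnePrime
import Summits.QuantumAdvantage.QuantumAdvantage.Theorems.LinnikCubicClassGroupsDegreeOnePrimesEscapeOneSidedFrobenius
import Summits.QuantumAdvantage.QuantumAdvantage.Theorems.LinnikCubicClassGroupsDegreeOnePrimesEscapeLeastPrimeIdeal
import HarnessLib

/-!
# The least prime with a prescribed Frobenius ELEMENT in a Galois number field, unconditionally

Topic `Summits/QuantumAdvantage/QuantumAdvantage/Theorems`, cell B2b-1 (linnik-cubic), PART A (gen 12); helper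
toward the crux `DegreeOnePrimesEscape` (stmt-QuantumAdvantage-11543) — the Lagarias–Montgomery–Odlyzko least prime
for conjugacy classes INSIDE a division, first unconditional form (bound in `Q = |d_N| nⁿ`).  HONEST FRAMING: the
value of this file is a THEOREM (kernel-checked, GRH-free) — NOT summit progress.

**Theorem** (`exists_prime_isArithFrobAt_le`).  For `n > 1` there is `L = L(n) > 0` such that for every Galois
number field `N` of degree `n` and every `σ ∈ Gal(N/ℚ)` that does not generate `Gal(N/ℚ)`, some rational prime
`p ∤ d_N` with `p ≤ (|d_N| nⁿ)^{L}` has a prime `𝔔 ∣ p` of `N` with `Frob_𝔔 = σ` (hence `Frob_p ∈ C(σ)`, the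
conjugacy class — not merely the division — of `σ`).  [LagariasMontgomeryOdlyzko1979, Theorem 1.1 (with
`|d_N|^{L}`; here `Q = |d_N| nⁿ`)]; the excluded case `⟨σ⟩ = Gal(N/ℚ)` is Linnik's theorem for the cyclotomic-type
(abelian) field `N` itself.

Proof: `E := N^{⟨σ⟩}`; `N|E` is cyclic with group `⟨σ⟩`, `1 < [E:ℚ]`; `exists_degOnePrime_galFrob_eq_absNorm_le`
gives a prime `𝔭` of `E`, `N𝔭 = p ∤ d_N`, unramified in `N`, with `Frob_{N|E}(𝔭) = σ` and `p ≤ Q^{L}`; for `𝔔 ∣ 𝔭`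
the congruence `σ x ≡ x^{N𝔭} = x^{p} (mod 𝔔)` says that `σ` is a Frobenius of `𝔔` over `ℤ`.
-/

noncomputable section

open Complex Real Finset NumberField IsDedekindDomain
open scoped NumberField nonZeroDivisors Classical

namespace Summit.QuantumAdvantage.QuantumAdvantage.Theorems.DegreeOnePrimesEscape

open Literature.NumberTheory.LFunctions Literature.NumberTheory.LFunctions.NumberField
  Literature.NumberTheory.GaloisRepresentations

variable {N : Type} [Field N] [NumberField N] [IsGalois ℚ N]

omit [IsGalois ℚ N] in
/-- **Frobenius over `𝓞_E` at a degree-one prime is Frobenius over `ℤ`.**  Let `E ⊆ N`, `σ ∈ Gal(N/ℚ)` fixing `E`,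
`𝔔` a prime of `N` above the prime `𝔭` of `E` with `N𝔭 = p` prime.  If `σ` (as an element of `Gal(N/E)`) is an
arithmetic Frobenius at `𝔔` over `𝓞_E`, then `σ` is an arithmetic Frobenius at `𝔔` over `ℤ`. -/
theorem isArithFrobAt_int_of_absNorm_prime (E : IntermediateField ℚ N) (σ : N ≃ₐ[ℚ] N) (hσ : σ ∈ E.fixingSubgroup)
    (v : HeightOneSpectrum (𝓞 E)) {Q : Ideal (𝓞 N)} (hQ : Q ∈ v.asIdeal.primesOver (𝓞 N))
    (hfrob : IsArithFrobAt (𝓞 E) (IntermediateField.fixingSubgroupEquiv E ⟨σ, hσ⟩) Q)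
    {p : ℕ} (hp : p.Prime) (hv : Ideal.absNorm v.asIdeal = p) :
    IsArithFrobAt ℤ σ Q ∧ Q.LiesOver (Ideal.span {(p : ℤ)}) := by
  haveI : Q.IsPrime := hQ.1
  have hover : v.asIdeal = Q.under (𝓞 E) := hQ.2.over
  -- `Q ∩ ℤ = (p)`
  have hpv : (p : 𝓞 E) ∈ v.asIdeal := by rw [← hv]; exact Ideal.absNorm_mem _
  have hunderZ : Q.under ℤ = Ideal.span {(p : ℤ)} := by
    haveI := Fact.mk hp
    rw [← Ideal.under_under (B := 𝓞 E) Q, ← hover]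
    refine (Ideal.IsMaximal.eq_of_le inferInstance (Ideal.IsPrime.under ℤ v.asIdeal).ne_top ?_).symm
    rw [Ideal.span_le, Set.singleton_subset_iff, SetLike.mem_coe, Ideal.under_def, Ideal.mem_comap, map_natCast]
    exact hpv
  refine ⟨?_, ⟨hunderZ.symm⟩⟩
  intro x
  have h := hfrob x
  -- the exponents agree: `#(𝓞_E/𝔭) = p = #(ℤ/p)`
  have hexpE : Nat.card (𝓞 E ⧸ Q.under (𝓞 E)) = p := by
    rw [← hover, ← Submodule.cardQuot_apply, ← Ideal.absNorm_apply, hv]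
  have hexpZ : Nat.card (ℤ ⧸ Q.under ℤ) = p := by rw [hunderZ, Int.card_ideal_quot]
  rw [hexpZ]
  rw [hexpE] at h
  -- the two actions of `σ` on `𝓞 N` agree
  have hact : (MulSemiringAction.toAlgHom (𝓞 E) (𝓞 N) (IntermediateField.fixingSubgroupEquiv E ⟨σ, hσ⟩)) x =
      (MulSemiringAction.toAlgHom ℤ (𝓞 N) σ) x := by
    apply Subtype.ext
    rfl
  rw [← hact]
  exact h

/-- **The least prime with a prescribed Frobenius element** (see the module docstring).
[cite: LagariasMontgomeryOdlyzko1979, Theorem 1.1] [cite: Weiss1983, Theorem 6.1] -/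
theorem exists_prime_isArithFrobAt_le (n : ℕ) (hn : 1 < n) :
    ∃ L : ℝ, 0 < L ∧ ∀ (N : Type) [Field N] [NumberField N] [IsGalois ℚ N],
      Module.finrank ℚ N = n → ∀ σ : N ≃ₐ[ℚ] N, Subgroup.zpowers σ ≠ ⊤ →
        ∃ p : ℕ, p.Prime ∧ (p : ℝ) ≤ ThornerZaman.condQn N ^ L ∧ ¬ ((p : ℤ) ∣ NumberField.discr N) ∧
          ∃ Q : Ideal (𝓞 N), Q.IsMaximal ∧ Q.LiesOver (Ideal.span {(p : ℤ)}) ∧ IsArithFrobAt ℤ σ Q := by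
  obtain ⟨L, hL, hmain⟩ := exists_degOnePrime_galFrob_eq_absNorm_le n hn
  refine ⟨L, hL, fun N _ _ _ hNn σ hσ ↦ ?_⟩
  -- the fixed field of `⟨σ⟩`
  set H : Subgroup (N ≃ₐ[ℚ] N) := Subgroup.zpowers σ with hH
  set E : IntermediateField ℚ N := IntermediateField.fixedField H with hE
  have hfix : E.fixingSubgroup = H := IntermediateField.fixingSubgroup_fixedField H
  have hσE : σ ∈ E.fixingSubgroup := by rw [hfix]; exact Subgroup.mem_zpowers σ
  haveI : IsCyclic E.fixingSubgroup := by rw [hfix]; infer_instance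
  haveI : IsCyclic (N ≃ₐ[E] N) :=
    isCyclic_of_surjective (IntermediateField.fixingSubgroupEquiv E).toMonoidHom
      (IntermediateField.fixingSubgroupEquiv E).surjective
  have hEdeg : 1 < Module.finrank ℚ E := one_lt_finrank_fixedField_of_ne_top H hσ
  set τ : N ≃ₐ[E] N := IntermediateField.fixingSubgroupEquiv E ⟨σ, hσE⟩ with hτ
  obtain ⟨v, hunr, hfrobv, hprime, hnd, hle⟩ := hmain E N hNn hEdeg τ
  obtain ⟨Q, hQ, hfrobQ⟩ := galFrob_spec E N v
  rw [hfrobv] at hfrobQ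
  obtain ⟨hZ, hlies⟩ := isArithFrobAt_int_of_absNorm_prime E σ hσE v hQ hfrobQ hprime rfl
  haveI : Q.IsPrime := hQ.1
  have hQ0 : Q ≠ ⊥ := Ideal.ne_bot_of_mem_primesOver v.ne_bot hQ
  exact ⟨Ideal.absNorm v.asIdeal, hprime, hle, hnd, Q, hQ.1.isMaximal hQ0, hlies, hZ⟩

/-- **The same with the bound `p ≤ |d_N|^{L'}`** (`Q = |d_N| nⁿ ≤ |d_N|^{1 + n log n/log 3}`,
`condQn_le_natAbs_discr_rpow`). [cite: LagariasMontgomeryOdlyzko1979, Theorem 1.1] -/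
theorem exists_prime_isArithFrobAt_le_discr_rpow (n : ℕ) (hn : 1 < n) :
    ∃ L : ℝ, 0 < L ∧ ∀ (N : Type) [Field N] [NumberField N] [IsGalois ℚ N],
      Module.finrank ℚ N = n → ∀ σ : N ≃ₐ[ℚ] N, Subgroup.zpowers σ ≠ ⊤ →
        ∃ p : ℕ, p.Prime ∧ (p : ℝ) ≤ ((NumberField.discr N).natAbs : ℝ) ^ L ∧ ¬ ((p : ℤ) ∣ NumberField.discr N) ∧
          ∃ Q : Ideal (𝓞 N), Q.IsMaximal ∧ Q.LiesOver (Ideal.span {(p : ℤ)}) ∧ IsArithFrobAt ℤ σ Q := by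
  obtain ⟨L, hL, hmain⟩ := exists_prime_isArithFrobAt_le n hn
  have hn0 : (0 : ℝ) < n := by exact_mod_cast (lt_trans Nat.zero_lt_one hn)
  have hlogn : 0 ≤ Real.log n := Real.log_nonneg (by exact_mod_cast hn.le)
  set e : ℝ := 1 + n * Real.log n / Real.log 3 with he
  have hlog3 : 0 < Real.log 3 := Real.log_pos (by norm_num)
  have he0 : 0 ≤ (n : ℝ) * Real.log n / Real.log 3 := by positivity
  have he1 : 1 ≤ e := by rw [he]; linarith
  refine ⟨e * L, by positivity, fun N _ _ _ hNn σ hσ ↦ ?_⟩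
  obtain ⟨p, hp, hple, hnd, Q, hQ⟩ := hmain N hNn σ hσ
  refine ⟨p, hp, hple.trans ?_, hnd, Q, hQ⟩
  have hN1 : 1 < Module.finrank ℚ N := by rw [hNn]; exact hn
  have hQd := condQn_le_natAbs_discr_rpow N hN1
  rw [hNn] at hQd
  have hd0 : (0 : ℝ) ≤ ((NumberField.discr N).natAbs : ℝ) := Nat.cast_nonneg _
  have hQ0 : (0 : ℝ) ≤ ThornerZaman.condQn N := by
    have := ThornerZaman.twelve_le_condQn (K := N) hN1; linarith
  calc ThornerZaman.condQn N ^ L ≤ (((NumberField.discr N).natAbs : ℝ) ^ e) ^ L :=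
        Real.rpow_le_rpow hQ0 hQd hL.le
    _ = ((NumberField.discr N).natAbs : ℝ) ^ (e * L) := by rw [Real.rpow_mul hd0]

end Summit.QuantumAdvantage.QuantumAdvantage.Theorems.DegreeOnePrimesEscape
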